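import Literature.NumberTheory.Transcendental.GaGmSectionData
import HarnessLib

/-!
# The components of the coordinate section of a connected subgroup of `G = 𝔾ₐ × 𝔾ₘⁿ`

Topic `Literature/NumberTheory/Transcendental`. Third helper file (after `GaGmSlices.lean`,
`GaGmSectionData.lean`) for the general-rank lower bound of the box multiplicity
`mult_{D₀,D₁}(V × T_A)` of a connected algebraic subgroup (the obstruction degree `𝓗(G*; D)` of
Nesterenko 2003, (5.7) / Philippon 1986, §3 Lemme 3.4, used in Prop. 5.1). Everything is PROVED.

For an irreducible closed subgroup `H` of dimension `d + 1`, its level subgroups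
`K_c = {g ∈ H ; coord_c g = coord_c e}` with identity components `K_c°` and coset families `𝒴_c`,
a finite set `good` of coordinates, multiplicities `m 0 ≤ D₀`, `m h.succ ≤ D₁`, and generic section
points `σ c i ∈ H` (`GaGm.exists_section_points`), the translates `σ c i · Y` (`c` good, `i < m c`,
`Y ∈ 𝒴_c`) are PAIRWISE DISTINCT irreducible components of `H ∩ Z(F)` for the section polynomial
`F = ∏_{c ∈ good} ∏_{i < m c} (X_c - coord_c (σ c i)) ∈ Box D₀ D₁ 1`, all of dimension `d`, and each
of multiplicity `mult(K_c°)`; the tree's Bézout section inequality `GaGm.sum_mult_section_le` then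
gives **`GaGm.section_sum_le_mult`**:
`∑_{c ∈ good} (m c) · #𝒴_c · mult_{D₀,D₁}(K_c°) ≤ mult_{D₀,D₁}(H)`.

## References

* P. Philippon, *Lemmes de zéros dans les groupes algébriques commutatifs*, Bull. Soc. Math.
  France 114 (1986), 355–383, §3 (Prop. 3.3, Lemme 3.4). [Philippon1986]
* Yu. V. Nesterenko, *Linear forms in logarithms of rational numbers*, LNM 1819 (2003), §5.1,
  (5.7) and Prop. 5.1. [Nesterenko2003]
-/

noncomputable section

open MvPolynomial Module
open scoped Pointwise

namespace Literature.NumberTheory.Transcendental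

namespace GaGm

variable {n : ℕ}

/-! ### Cosets as sets -/

/-- Two cosets `g·A = g'·B` of subgroups which coincide as sets have `A = B`.
[cite: Borel1991, §1.2] -/
theorem coe_eq_of_smul_coe_eq {A B : Subgroup (GaGm n)} {g g' : GaGm n}
    (h : g • (A : Set (GaGm n)) = g' • (B : Set (GaGm n))) : (A : Set (GaGm n)) = (B : Set (GaGm n)) := by
  -- `g = g' b₀` with `b₀ ∈ B`
  have hg : g ∈ g' • (B : Set (GaGm n)) := by
    rw [← h]; exact ⟨1, A.one_mem, by simp⟩
  obtain ⟨b₀, hb₀, hgb⟩ := Set.mem_smul_set.mp hg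
  rw [smul_eq_mul] at hgb
  have hA : (A : Set (GaGm n)) = b₀⁻¹ • (B : Set (GaGm n)) := by
    have := congrArg (fun S : Set (GaGm n) => g⁻¹ • S) h
    simp only [inv_smul_smul] at this
    rw [this, smul_smul, ← hgb, mul_inv_rev, mul_assoc, inv_mul_cancel, mul_one]
  rw [hA]
  ext x
  constructor
  · rintro ⟨b, hb, rfl⟩
    exact B.mul_mem (B.inv_mem hb₀) hb
  · intro hx
    exact ⟨b₀ * x, B.mul_mem hb₀ hx, by simp⟩

/-- A coset `f·A` of a subgroup containing `e` is `A`. [cite: Borel1991, §1.2] -/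
theorem smul_coe_eq_of_one_mem {A : Subgroup (GaGm n)} {f : GaGm n} (h1 : (1 : GaGm n) ∈ f • (A : Set (GaGm n))) :
    f • (A : Set (GaGm n)) = (A : Set (GaGm n)) := by
  obtain ⟨a, ha, hfa⟩ := Set.mem_smul_set.mp h1
  rw [smul_eq_mul, mul_eq_one_iff_eq_inv] at hfa
  have hf : f ∈ A := by rw [hfa]; exact A.inv_mem ha
  ext x
  constructor
  · rintro ⟨a', ha', rfl⟩; exact A.mul_mem hf ha'
  · intro hx; exact ⟨f⁻¹ * x, A.mul_mem (A.inv_mem hf) hx, by simp⟩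

/-- In a translate `σ·K` of a level set `K ⊆ {coord_c = coord_c e}` the `c`-th coordinate is
constant, equal to `coord_c σ`. [cite: Borel1991, §8.5] -/
theorem coord_eq_of_mem_smul_level {H K : Subgroup (GaGm n)} {c : Fin (n + 1)}
    (hK : (K : Set (GaGm n)) = {g : GaGm n | g ∈ H ∧ coord g c = coord (1 : GaGm n) c})
    {σ z : GaGm n} (hz : z ∈ σ • (K : Set (GaGm n))) : coord z c = coord σ c := by
  obtain ⟨g, hg, rfl⟩ := Set.mem_smul_set.mp hz
  have hg' : g ∈ {g : GaGm n | g ∈ H ∧ coord g c = coord (1 : GaGm n) c} := hK ▸ hg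
  exact coord_mul_eq_of_coord_eq hg'.2 σ

/-! ### The Bézout inequality for the coordinate section -/

/-- **The components of the coordinate section and the Bézout inequality.** With the notation of
the module docstring: the translates `σ c i · Y` (`c ∈ good`, `i < m c`, `Y ∈ 𝒴_c`) are pairwise
distinct components of `H ∩ Z(F)`, each of dimension `d` and multiplicity `mult(K_c°)`, so that
`∑_{c ∈ good} (m c) · #𝒴_c · mult(K_c°) ≤ mult(H)`; moreover `dim K_c° = d` for `c ∈ good`.
[cite: Philippon1986, §3 Prop. 3.3 and Lemme 3.4; Nesterenko2003, §5.1 (5.7)] -/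
theorem section_sum_le_mult {D₀ D₁ : ℕ} (hD₀ : 1 ≤ D₀) (hD₁ : 1 ≤ D₁)
    (H : Subgroup (GaGm n)) (hirr : IsIrred (H : Set (GaGm n))) {d : ℕ} (hdim : dimG (H : Set (GaGm n)) = d + 1)
    (K : Fin (n + 1) → Subgroup (GaGm n))
    (hK : ∀ c, (K c : Set (GaGm n)) = {g : GaGm n | g ∈ H ∧ coord g c = coord (1 : GaGm n) c})
    (hKcl : ∀ c, IsClosedG (K c : Set (GaGm n)))
    (𝒴 : Fin (n + 1) → Finset (Set (GaGm n)))
    (h𝒴 : ∀ c, ∀ Y ∈ 𝒴 c, ∃ f ∈ K c, Y = f • ((idComp (K c) (hKcl c) : Subgroup (GaGm n)) : Set (GaGm n)))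
    (hcov : ∀ c, (K c : Set (GaGm n)) = ⋃ Y ∈ 𝒴 c, Y)
    (good : Finset (Fin (n + 1))) (m : Fin (n + 1) → ℕ) (hm0 : m 0 ≤ D₀) (hm : ∀ h : Fin n, m h.succ ≤ D₁)
    (σ : Fin (n + 1) → ℕ → GaGm n) (h1 : ∀ c i, σ c i ∈ H)
    (h2 : ∀ c ∈ good, ∀ i i', coord (σ c i) c = coord (σ c i') c → i = i')
    (h3 : ∀ c ∈ good, ∀ i, coord (σ c i) c ≠ coord (1 : GaGm n) c)
    (h4 : ∀ c ∈ good, ∀ c' ∈ good, c ≠ c' → ∀ i, ∀ i' < m c',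
        (((fun g : GaGm n => coord g c) '' (σ c' i' • (K c' : Set (GaGm n)))).Finite →
            coord (σ c i) c ∉ (fun g : GaGm n => coord g c) '' (σ c' i' • (K c' : Set (GaGm n)))) ∨
        ∀ i'', i < m c → (((fun g : GaGm n => coord g c') '' (σ c i • (K c : Set (GaGm n)))).Finite →
            coord (σ c' i'') c' ∉ (fun g : GaGm n => coord g c') '' (σ c i • (K c : Set (GaGm n))))) :
    (∑ c ∈ good, m c * (𝒴 c).card * mult D₀ D₁ ((idComp (K c) (hKcl c) : Subgroup (GaGm n)) : Set (GaGm n))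
        ≤ mult D₀ D₁ (H : Set (GaGm n))) ∧
      ∀ c ∈ good, dimG ((idComp (K c) (hKcl c) : Subgroup (GaGm n)) : Set (GaGm n)) = d := by
  classical
  -- notation
  set K₀ : Fin (n + 1) → Subgroup (GaGm n) := fun c => idComp (K c) (hKcl c) with hK₀def
  set F : MvPolynomial (Fin (n + 1)) ℂ :=
    ∏ c ∈ good, ∏ i ∈ Finset.range (m c), (X c - C (coord (σ c i) c)) with hFdef
  have hFB : F ∈ Box (n := n) D₀ D₁ 1 := sectionPoly_mem_Box good m σ hm0 hm
  have hFv : F ∉ vanishing (H : Set (GaGm n)) := sectionPoly_notMem_vanishing H good m σ h3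
  set Z₀ : Set (GaGm n) := (H : Set (GaGm n)) ∩ zeroSet {F} with hZ₀def
  have hZ₀cl : IsClosedG Z₀ := hirr.isClosedG.inter (isClosedG_zeroSet _)
  have hKleH : ∀ c, K c ≤ H := fun c g hg => by
    have : g ∈ {g : GaGm n | g ∈ H ∧ coord g c = coord (1 : GaGm n) c} := (hK c) ▸ hg
    exact this.1
  have hK₀le : ∀ c, K₀ c ≤ K c := fun c => idComp_le (K c) (hKcl c)
  have hK₀irr : ∀ c, IsIrred (K₀ c : Set (GaGm n)) := fun c => isIrred_idComp (K c) (hKcl c)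
  -- the level set as a hypersurface section, and the dimension of `K₀ c` for good `c`
  have hdimK₀ : ∀ c ∈ good, dimG (K₀ c : Set (GaGm n)) = d := by
    intro c hc
    set ℓ : MvPolynomial (Fin (n + 1)) ℂ := X c - C (coord (1 : GaGm n) c) with hℓ
    have hℓv : ℓ ∉ vanishing (H : Set (GaGm n)) := by
      intro hv
      have := hv (σ c 0) (h1 c 0)
      rw [hℓ, evalAt_eq_eval, map_sub, eval_X, eval_C, sub_eq_zero] at this
      exact h3 c hc 0 this
    have hKc : (K c : Set (GaGm n)) = (H : Set (GaGm n)) ∩ zeroSet {ℓ} := by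
      rw [hK c, level_eq_inter_zeroSet]
    obtain ⟨h𝔮, -⟩ := idCompSet_spec (K c) (hKcl c)
    rw [mem_comps] at h𝔮
    have h𝔮' : Classical.choose (exists_comps_one_mem (K c) (hKcl c)) ∈
        (vanishing ((H : Set (GaGm n)) ∩ zeroSet {ℓ})).minimalPrimes := by
      rw [← hKc]; exact h𝔮
    have hd := dimG_add_one_of_mem_minimalPrimes_section hirr hℓv h𝔮'
    rw [hdim] at hd
    have hK₀eq : (K₀ c : Set (GaGm n)) =
        zeroSet (n := n) ((Classical.choose (exists_comps_one_mem (K c) (hKcl c)) :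
          Ideal (MvPolynomial (Fin (n + 1)) ℂ)) : Set (MvPolynomial (Fin (n + 1)) ℂ)) := rfl
    rw [hK₀eq]
    omega
  refine ⟨?_, hdimK₀⟩
  -- the index set and the components
  set 𝓘 : Finset (Σ _ : Fin (n + 1), ℕ × Set (GaGm n)) :=
    good.sigma fun c => (Finset.range (m c)) ×ˢ (𝒴 c) with h𝓘def
  let comp : (Σ _ : Fin (n + 1), ℕ × Set (GaGm n)) → Set (GaGm n) := fun ι => σ ι.1 ι.2.1 • ι.2.2
  have hmem𝓘 : ∀ ι ∈ 𝓘, ι.1 ∈ good ∧ ι.2.1 < m ι.1 ∧ ι.2.2 ∈ 𝒴 ι.1 := by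
    rintro ⟨c, i, Y⟩ hι
    rw [h𝓘def, Finset.mem_sigma, Finset.mem_product, Finset.mem_range] at hι
    exact ⟨hι.1, hι.2.1, hι.2.2⟩
  -- basic properties of one component
  have hcompIrr : ∀ ι ∈ 𝓘, IsIrred (comp ι) := by
    intro ι hι
    obtain ⟨-, -, hY⟩ := hmem𝓘 ι hι
    obtain ⟨f, -, hYf⟩ := h𝒴 ι.1 ι.2.2 hY
    change IsIrred (σ ι.1 ι.2.1 • ι.2.2)
    rw [hYf]
    exact ((hK₀irr ι.1).smul f).smul _
  have hcompSubK : ∀ ι ∈ 𝓘, comp ι ⊆ σ ι.1 ι.2.1 • (K ι.1 : Set (GaGm n)) := by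
    intro ι hι
    obtain ⟨-, -, hY⟩ := hmem𝓘 ι hι
    obtain ⟨f, hf, hYf⟩ := h𝒴 ι.1 ι.2.2 hY
    change σ ι.1 ι.2.1 • ι.2.2 ⊆ _
    refine Set.smul_set_mono ?_
    rw [hYf]
    rintro _ ⟨k, hk, rfl⟩
    exact (K ι.1).mul_mem hf (hK₀le ι.1 hk)
  have hcompCoord : ∀ ι ∈ 𝓘, ∀ z ∈ comp ι, coord z ι.1 = coord (σ ι.1 ι.2.1) ι.1 := fun ι hι z hz =>
    coord_eq_of_mem_smul_level (hK ι.1) (hcompSubK ι hι hz)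
  have hcompSubX : ∀ ι ∈ 𝓘, comp ι ⊆ Z₀ := by
    intro ι hι z hz
    obtain ⟨hc, hi, -⟩ := hmem𝓘 ι hι
    have hzK := hcompSubK ι hι hz
    obtain ⟨g, hg, rfl⟩ := Set.mem_smul_set.mp hzK
    refine ⟨H.mul_mem (h1 _ _) (hKleH _ hg), fun P hP => ?_⟩
    rw [Set.mem_singleton_iff.mp hP, hFdef, evalAt_sectionPoly_eq_zero_iff]
    exact ⟨ι.1, hc, ι.2.1, hi, hcompCoord ι hι _ hz⟩
  have hcompDim : ∀ ι ∈ 𝓘, dimG (comp ι) = d := by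
    intro ι hι
    obtain ⟨hc, -, hY⟩ := hmem𝓘 ι hι
    obtain ⟨f, -, hYf⟩ := h𝒴 ι.1 ι.2.2 hY
    change dimG (σ ι.1 ι.2.1 • ι.2.2) = d
    rw [dimG_smul, hYf, dimG_smul]
    exact hdimK₀ ι.1 hc
  have hcompMult : ∀ ι ∈ 𝓘, mult D₀ D₁ (comp ι) = mult D₀ D₁ (K₀ ι.1 : Set (GaGm n)) := by
    intro ι hι
    obtain ⟨-, -, hY⟩ := hmem𝓘 ι hι
    obtain ⟨f, -, hYf⟩ := h𝒴 ι.1 ι.2.2 hY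
    change mult D₀ D₁ (σ ι.1 ι.2.1 • ι.2.2) = _
    rw [hYf, mult_smul hD₀ hD₁ ((hK₀irr ι.1).smul f), mult_smul hD₀ hD₁ (hK₀irr ι.1)]
  -- every component has the dimension of `Z₀`, hence is a component of `Z₀`
  have hcompDimX : ∀ ι ∈ 𝓘, dimG (comp ι) = dimG Z₀ := by
    intro ι hι
    have hXne : Z₀.Nonempty := ((hcompIrr ι hι).nonempty).mono (hcompSubX ι hι)
    obtain ⟨𝔮, h𝔮, hd𝔮⟩ := exists_minimalPrimes_dimG_eq hXne
    have := dimG_add_one_of_mem_minimalPrimes_section hirr hFv h𝔮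
    rw [hcompDim ι hι]
    omega
  set MP := (Ideal.finite_minimalPrimes_of_isNoetherianRing _ (vanishing Z₀)).toFinset with hMPdef
  have hcompPrime : ∀ ι ∈ 𝓘, vanishing (comp ι) ∈ MP ∧ zeroSet (↑(vanishing (comp ι)) : Set (MvPolynomial (Fin (n + 1)) ℂ)) = comp ι := by
    intro ι hι
    obtain ⟨𝔮, h𝔮, heq⟩ := (hcompIrr ι hι).exists_eq_zeroSet_minimalPrimes hZ₀cl (hcompSubX ι hι) (hcompDimX ι hι)
    obtain ⟨-, hv, -⟩ := isIrred_zeroSet_of_mem_minimalPrimes h𝔮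
    rw [heq, hv, hMPdef, Set.Finite.mem_toFinset]
    exact ⟨h𝔮, rfl⟩
  -- finiteness of the `c`-values on `σ' · K c'` when `K₀ c' = K₀ c`
  have hfinval : ∀ c c' : Fin (n + 1), (K₀ c' : Set (GaGm n)) = (K₀ c : Set (GaGm n)) → ∀ τ : GaGm n,
      ((fun g : GaGm n => coord g c) '' (τ • (K c' : Set (GaGm n)))).Finite := by
    intro c c' hKK τ
    rw [hcov c', Set.smul_set_iUnion₂, Set.image_iUnion₂]
    refine Set.Finite.biUnion (Finset.finite_toSet _) fun Y hY => ?_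
    obtain ⟨f, -, hYf⟩ := h𝒴 c' Y hY
    refine Set.Subsingleton.finite ?_
    rintro _ ⟨z, hz, rfl⟩ _ ⟨z', hz', rfl⟩
    rw [hYf, hKK, smul_smul] at hz hz'
    have hz1 : coord z c = coord (τ * f) c := by
      obtain ⟨k, hk, rfl⟩ := Set.mem_smul_set.mp hz
      have hk' : k ∈ {g : GaGm n | g ∈ H ∧ coord g c = coord (1 : GaGm n) c} := (hK c) ▸ (hK₀le c hk)
      exact coord_mul_eq_of_coord_eq hk'.2 _
    have hz2 : coord z' c = coord (τ * f) c := by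
      obtain ⟨k, hk, rfl⟩ := Set.mem_smul_set.mp hz'
      have hk' : k ∈ {g : GaGm n | g ∈ H ∧ coord g c = coord (1 : GaGm n) c} := (hK c) ▸ (hK₀le c hk)
      exact coord_mul_eq_of_coord_eq hk'.2 _
    change coord z c = coord z' c
    rw [hz1, hz2]
  -- pairwise distinctness of the components
  have hdist : ∀ ι ∈ 𝓘, ∀ κ ∈ 𝓘, comp ι = comp κ → ι = κ := by
    rintro ⟨c, i, Y⟩ hι ⟨c', i', Y'⟩ hκ heq
    obtain ⟨hc, hi, hY⟩ := hmem𝓘 _ hι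
    obtain ⟨hc', hi', hY'⟩ := hmem𝓘 _ hκ
    obtain ⟨f, hf, hYf⟩ := h𝒴 c Y hY
    obtain ⟨f', hf', hYf'⟩ := h𝒴 c' Y' hY'
    change σ c i • Y = σ c' i' • Y' at heq
    -- a common point
    have hz : σ c i * f ∈ σ c i • Y := by
      rw [hYf]; exact ⟨f, ⟨1, (K₀ c).one_mem, by simp⟩, rfl⟩
    have hz' : σ c' i' * f' ∈ σ c' i' • Y' := by
      rw [hYf']; exact ⟨f', ⟨1, (K₀ c').one_mem, by simp⟩, rfl⟩
    by_cases hcc : c = c'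
    · subst hcc
      -- same coordinate: the `c`-values agree, so `i = i'`, then `Y = Y'`
      have hval : coord (σ c i) c = coord (σ c i') c := by
        have h1v := hcompCoord ⟨c, i, Y⟩ hι (σ c i * f) hz
        rw [heq] at hz
        have h2v := hcompCoord ⟨c, i', Y'⟩ hκ (σ c i * f) hz
        exact h1v.symm.trans h2v
      have hii : i = i' := h2 c hc i i' hval
      subst hii
      have hYY : Y = Y' := smul_left_cancel_iff (g := σ c i) |>.mp heq
      subst hYY
      rfl
    · exfalso
      -- different coordinates: the identity components coincide
      have hKK : (K₀ c : Set (GaGm n)) = (K₀ c' : Set (GaGm n)) := by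
        rw [hYf, hYf', smul_smul, smul_smul] at heq
        exact coe_eq_of_smul_coe_eq heq
      have hfin1 := hfinval c c' hKK.symm (σ c' i')
      have hfin2 := hfinval c' c hKK (σ c i)
      rcases h4 c hc c' hc' hcc i i' hi' with h | h
      · apply h hfin1
        -- the point `σ c i * f` lies in `comp κ ⊆ σ' • K c'` and has `c`-value `coord (σ c i) c`
        have hmem : σ c i * f ∈ σ c' i' • (K c' : Set (GaGm n)) := by
          have := hz; rw [heq] at this
          exact hcompSubK ⟨c', i', Y'⟩ hκ this
        refine ⟨σ c i * f, hmem, ?_⟩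
        exact hcompCoord ⟨c, i, Y⟩ hι _ hz
      · apply h i' hi hfin2
        have hmem : σ c' i' * f' ∈ σ c i • (K c : Set (GaGm n)) := by
          have := hz'; rw [← heq] at this
          exact hcompSubK ⟨c, i, Y⟩ hι this
        refine ⟨σ c' i' * f', hmem, ?_⟩
        exact hcompCoord ⟨c', i', Y'⟩ hκ _ hz'
  -- the Bézout inequality
  have hsec := sum_mult_section_le hD₀ hD₁ hirr hFB hFv
  rw [← hZ₀def, ← hMPdef] at hsec
  have hinj : ∀ ι ∈ 𝓘, ∀ κ ∈ 𝓘, vanishing (comp ι) = vanishing (comp κ) → ι = κ := by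
    intro ι hι κ hκ h
    apply hdist ι hι κ hκ
    rw [← (hcompPrime ι hι).2, ← (hcompPrime κ hκ).2, h]
  calc ∑ c ∈ good, m c * (𝒴 c).card * mult D₀ D₁ (K₀ c : Set (GaGm n))
      = ∑ ι ∈ 𝓘, mult D₀ D₁ (comp ι) := by
        rw [h𝓘def, Finset.sum_sigma]
        refine Finset.sum_congr rfl fun c hc => ?_
        rw [Finset.sum_product]
        have : ∀ i ∈ Finset.range (m c), ∑ Y ∈ 𝒴 c, mult D₀ D₁ (comp ⟨c, i, Y⟩) =
            (𝒴 c).card * mult D₀ D₁ (K₀ c : Set (GaGm n)) := by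
          intro i hi
          exact Finset.sum_const_nat fun Y hY => hcompMult ⟨c, i, Y⟩
            (by rw [h𝓘def, Finset.mem_sigma, Finset.mem_product]; exact ⟨hc, hi, hY⟩)
        rw [Finset.sum_congr rfl this, Finset.sum_const, Finset.card_range, smul_eq_mul, mul_assoc]
    _ = ∑ ι ∈ 𝓘, mult D₀ D₁ (zeroSet (↑(vanishing (comp ι)) : Set (MvPolynomial (Fin (n + 1)) ℂ))) :=
        Finset.sum_congr rfl fun ι hι => by rw [(hcompPrime ι hι).2]
    _ = ∑ 𝔮 ∈ 𝓘.image (fun ι => vanishing (comp ι)),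
          mult D₀ D₁ (zeroSet (n := n) (𝔮 : Set (MvPolynomial (Fin (n + 1)) ℂ))) :=
        (Finset.sum_image (f := fun 𝔮 : Ideal (MvPolynomial (Fin (n + 1)) ℂ) =>
          mult D₀ D₁ (zeroSet (n := n) (𝔮 : Set (MvPolynomial (Fin (n + 1)) ℂ)))) hinj).symm
    _ ≤ ∑ 𝔮 ∈ MP, mult D₀ D₁ (zeroSet (n := n) (𝔮 : Set (MvPolynomial (Fin (n + 1)) ℂ))) := by
        refine Finset.sum_le_sum_of_subset fun 𝔮 h𝔮 => ?_
        obtain ⟨ι, hι, rfl⟩ := Finset.mem_image.mp h𝔮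
        exact (hcompPrime ι hι).1
    _ ≤ mult D₀ D₁ (H : Set (GaGm n)) := hsec

end GaGm

end Literature.NumberTheory.Transcendental
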